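import Mathlib.Analysis.SpecialFunctions.Trigonometric.Basic
import Mathlib.Data.Fin.VecNotation
import Mathlib.Topology.MetricSpace.HolderNorm
import Mathlib.Topology.Sets.Opens
import Literature.Analysis.FluidPDE.VectorCalculus
import Literature.Analysis.FluidPDE.ClassicalSolution
import Literature.Analysis.FluidPDE.Vorticity
import Literature.Analysis.FunctionSpaces.HolderNorm
import HarnessLib

-- provenance: harness21/H21/H21/Prelude/FluidKinetic/AxisymmetricEuler.lean @ 95cd6fb (interim HEAD d8f2665); M5 mechanical rewrite
/-!
# Axisymmetric flows, swirl, and the Euler equations on domains with boundary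

Trunk: FluidKinetic (outline `H21/Outlines/FluidKinetic.md`, item F11 `AxisymmetricEuler`;
notions `axisymmetric_class`, `euler_domain_with_boundary`).

Physical space is `ℝ³ = EuclideanSpace ℝ (Fin 3)` with coordinates `x 0, x 1, x 2` (the axis of
symmetry is the `x 2`-axis). In cylindrical coordinates `(r, θ, z)`,
`r = cylRadius x = √(x₀² + x₁²)`, a vector field is *axisymmetric* if it commutes with all
rotations `rotZ θ` about the `z`-axis, `u (R_θ x) = R_θ (u x)`; it then decomposes as
`u = u_r e_r + u_θ e_θ + u_z e_z` with components independent of `θ`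
(Koch–Nadirashvili–Seregin–Šverák 2009, §1, (1.5)–(1.8); Majda–Bertozzi, §2.3.3). The *swirl*
is `Γ = r u_θ = x₀ u₁ − x₁ u₀`, which for the Navier–Stokes equations satisfies the
drift–diffusion equation `∂ₜΓ + (u·∇)Γ = ν(Δ − (2/r)∂ᵣ)Γ` (KNSS 2009, (1.8); Chen–Hou 2022,
(1.1)–(1.3) in the `(u^θ, ω^θ, ψ^θ)` variables); *no swirl* means `u_θ ≡ 0`
(Elgindi 2021, §1.2: `C^{1,α}` axisymmetric no-swirl blow-up for 3D Euler).

## Main definitions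

* `Literature.Fluid.rotZ θ`: the rotation by angle `θ` about the `x 2`-axis (an isometry,
  `norm_rotZ`; a one-parameter group, `rotZ_add`, `rotZ_zero`).
* `Literature.Fluid.IsAxisymmetric u`, `Literature.Fluid.IsAxisymmetricScalar p`: invariance under all `rotZ θ`.
* `Literature.Analysis.FluidPDE.cylRadius`, the cylindrical frame `Literature.Analysis.FluidPDE.eR`, `Literature.Analysis.FluidPDE.eTheta`, `Literature.Analysis.FluidPDE.eZ`
  and the components `radialVelocity`, `swirlVelocity` (`u_θ`), `axialVelocity`.
* `Literature.Fluid.swirl u x = x 0 * u x 1 - x 1 * u x 0` (`Γ = r u_θ`, **junk-free**: a polynomial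
  expression, vanishing on the axis) and `Literature.Fluid.HasNoSwirl u`.
* `Literature.Fluid.IsClassicalEulerOnDomain S Ω n f u p`: classical (`C¹` up to the boundary)
  solutions of the forced incompressible Euler equations in an open set `Ω : Opens E` of a
  finite-dimensional inner product space, with the slip (no-penetration) condition `u · n = 0`
  on `frontier Ω` (Majda–Bertozzi, §1.2 / eq. (1.19)–(1.20) with boundary; Elgindi 2021, §1.2;
  Chen–Hou 2022, (1.1)–(1.3) in the cylinder `r < 1`).
* `Literature.Fluid.unitCylinder : Opens ℝ³` (`{r < 1}`, outward normal `eR`),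
  `Literature.Fluid.IsAxiallyPeriodic L v` (periodicity in `z`, Chen–Hou 2022, §1.1),
  `Literature.Fluid.MemC1Holder α v` (`C^{1,α}`, an abbreviation of the accepted G03
  `Literature.MemContDiffHolder 1 α`), `Literature.Fluid.HasFiniteEnergy v` (`∫ ‖v‖² < ∞`),
  `Literature.Fluid.VorticityBlowsUpAt u T` (`limsup_{t ↑ T} ‖ω(t)‖_∞ = ∞`, the Beale–Kato–Majda form,
  stated with `∃ᶠ` and no `sSup` junk).

## Main statements

* real proofs: `rotZ_zero`, `rotZ_add`, `norm_rotZ`, `swirl_eq_cylRadius_mul_swirlVelocity`,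
  `IsAxisymmetric.swirl_rotZ` (the swirl of an axisymmetric field is an axisymmetric scalar),
  `hasNoSwirl_iff_swirlVelocity`, `swirl_eq_zero_of_cylRadius_eq_zero`, `cylRadius_rotZ`,
  `cylRadius_smul`, `frontier_unitCylinder` (`∂{r < 1} = {r = 1}`).
* named facts (`def … : Prop`, results in print): `swirl_transport` (KNSS 2009, (1.8)),
  `IsClassicalNSSolutionOn.isAxisymmetric_of_data` (rotation invariance + uniqueness of decaying
  classical solutions, Majda–Bertozzi, §2.3.3 and §3.1.1 Cor. 3.1); the latter is **proved** in
  `Literature.Analysis.FluidPDE.AxisymmetricEulerProofs`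
  (`IsClassicalNSSolutionOn.isAxisymmetric_of_data_holds`).

## Mathlib search

Mathlib (this pin) has no axisymmetry, cylindrical coordinates or Euler-with-boundary notions
(searched `xisymm`, `cylindrical`, `swirl`: nothing relevant; `Orientation.rotation` is the
planar rotation of a `2`-dimensional oriented inner product space and does not directly give the
rotation of `EuclideanSpace ℝ (Fin 3)` about an axis). Used from Mathlib: `Real.cos`, `Real.sin`,
`Matrix.vecCons` (`![…]`), `WithLp.toLp`, `EuclideanSpace.single`, `TopologicalSpace.Opens`,
`frontier`, `closure`, `ContDiffOn`, `Filter.Frequently`, `nhdsWithin`; from H21: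
`Fluid.timeDerivWithin`, `Fluid.convect`, `Fluid.divergence`, `Fluid.partialDeriv`, `Fluid.curl`,
`Fluid.eEnergy`, `Fluid.IsClassicalNSSolutionOn`, `Fluid.HasUniformRapidDecayOn`,
`Literature.Analysis.FunctionSpaces.MemContDiffHolder`.

## Design notes

* Junk values: `eR x = eTheta x = 0` on the axis `{r = 0}` (from `0⁻¹ = 0`), hence
  `radialVelocity u x = swirlVelocity u x = 0` there; statements use the junk-free `swirl`
  (`Γ = r u_θ`) instead, and `swirl_eq_cylRadius_mul_swirlVelocity` holds off the axis. On the
  axis `swirl u x = 0` genuinely (`swirl_eq_zero_of_cylRadius_eq_zero`), so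
  `hasNoSwirl_iff_swirlVelocity` holds for every `u`.
* `IsClassicalEulerOnDomain` takes `Ω : Opens E` (no `isOpen` field); the spatial derivatives
  are plain `fderiv`s at interior points, the time derivative is the one-sided
  `timeDerivWithin S` of `ClassicalSolution`; `u`, `p` are `C¹` on `S ×ˢ closure Ω`, so that the
  slip condition on `frontier Ω` refers to the continuous boundary values. The normal field `n`
  is an argument (for `unitCylinder` take `n = eR`).
* `swirl_transport` and `isAxisymmetric_of_data` are stated for the whole-space classical
  solutions `IsClassicalNSSolutionOn` of `ClassicalSolution` (KNSS 2009 work on `ℝ³ × (−∞, 0)`).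

## References

* G. Koch, N. Nadirashvili, G. Seregin, V. Šverák, *Liouville theorems for the Navier–Stokes
  equations and applications*, Acta Math. 203 (2009), §1, eqs. (1.5)–(1.8).
* T. M. Elgindi, *Finite-time singularity formation for `C^{1,α}` solutions to the incompressible
  Euler equations on `ℝ³`*, Ann. of Math. 194 (2021), §1.2.
* J. Chen, T. Y. Hou, *Stable nearly self-similar blowup of the 2D Boussinesq and 3D Euler
  equations with smooth data*, arXiv:2210.07191 (2022), §1.1, eqs. (1.1)–(1.3).
* A. J. Majda, A. L. Bertozzi, *Vorticity and Incompressible Flow* (CUP 2002), §2.3.3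
  (axisymmetric flows, eqs. (2.56)–(2.61)), §3.1.1 Prop. 3.1 / Cor. 3.1 (basic energy
  estimate, uniqueness of smooth decaying solutions), Thm. 3.6 / (3.72) (Beale–Kato–Majda).
-/

noncomputable section

open MeasureTheory Set Function Filter Topology TopologicalSpace WithLp
open scoped Laplacian InnerProductSpace RealInnerProductSpace NNReal ENNReal

namespace Literature.Analysis.FluidPDE

/-- Local notation for physical space `ℝ³ = EuclideanSpace ℝ (Fin 3)`. -/
local notation "ℝ³" => EuclideanSpace ℝ (Fin 3)

/-! ### Rotations about the axis and axisymmetry -/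

/-- The rotation `R_θ` of `ℝ³` by the angle `θ` about the `x 2`-axis (the `z`-axis):
`R_θ (x₀, x₁, x₂) = (cos θ x₀ − sin θ x₁, sin θ x₀ + cos θ x₁, x₂)`
(KNSS 2009, §1, before (1.5); Majda–Bertozzi, §2.3.3). [cite: KNSS2009, §1 before (1.5)] -/
def rotZ (θ : ℝ) (x : ℝ³) : ℝ³ :=
  toLp 2 ![Real.cos θ * x 0 - Real.sin θ * x 1, Real.sin θ * x 0 + Real.cos θ * x 1, x 2]

/-- First component of the rotation: `(R_θ x)₀ = cos θ x₀ − sin θ x₁`. [folklore] -/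
@[simp] theorem rotZ_apply_zero (θ : ℝ) (x : ℝ³) :
    rotZ θ x 0 = Real.cos θ * x 0 - Real.sin θ * x 1 := rfl

/-- Second component of the rotation: `(R_θ x)₁ = sin θ x₀ + cos θ x₁`. [folklore] -/
@[simp] theorem rotZ_apply_one (θ : ℝ) (x : ℝ³) :
    rotZ θ x 1 = Real.sin θ * x 0 + Real.cos θ * x 1 := rfl

/-- Third component of the rotation: `(R_θ x)₂ = x₂` (the axis is fixed). [folklore] -/
@[simp] theorem rotZ_apply_two (θ : ℝ) (x : ℝ³) : rotZ θ x 2 = x 2 := rfl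

/-- `R_0 = id` (KNSS 2009, §1). [cite: KNSS2009, §1] -/
@[simp]
theorem rotZ_zero (x : ℝ³) : rotZ 0 x = x := by
  ext i
  fin_cases i <;> simp

/-- The rotations about the axis form a one-parameter group: `R_{θ+φ} = R_θ ∘ R_φ`
(KNSS 2009, §1). [cite: KNSS2009, §1] -/
theorem rotZ_add (θ φ : ℝ) (x : ℝ³) : rotZ (θ + φ) x = rotZ θ (rotZ φ x) := by
  ext i
  fin_cases i
  · simp [Real.cos_add, Real.sin_add]; ring
  · simp [Real.cos_add, Real.sin_add]; ring
  · simp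

/-- Rotations about the axis are isometries: `‖R_θ x‖ = ‖x‖` (KNSS 2009, §1). [cite: KNSS2009, §1] -/
theorem norm_rotZ (θ : ℝ) (x : ℝ³) : ‖rotZ θ x‖ = ‖x‖ := by
  rw [EuclideanSpace.norm_eq, EuclideanSpace.norm_eq]
  congr 1
  simp only [Fin.sum_univ_three, Real.norm_eq_abs, sq_abs, rotZ_apply_zero, rotZ_apply_one,
    rotZ_apply_two]
  linear_combination (x 0 ^ 2 + x 1 ^ 2) * Real.sin_sq_add_cos_sq θ

/-- A vector field `u : ℝ³ → ℝ³` is *axisymmetric* (about the `x 2`-axis) if it is equivariant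
under all rotations about the axis, `u (R_θ x) = R_θ (u x)`; equivalently its cylindrical
components `u_r, u_θ, u_z` do not depend on the angle (KNSS 2009, §1, (1.5); Majda–Bertozzi,
§2.3.3; Elgindi 2021, §1.2). [cite: KNSS2009, §1 (1.5)] -/
def IsAxisymmetric (u : ℝ³ → ℝ³) : Prop :=
  ∀ θ x, u (rotZ θ x) = rotZ θ (u x)

/-- A scalar field `p : ℝ³ → α` (pressure, swirl, …) is *axisymmetric* if it is invariant under
all rotations about the axis, `p (R_θ x) = p x` (KNSS 2009, §1). [cite: KNSS2009, §1] -/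
def IsAxisymmetricScalar {α : Sort*} (p : ℝ³ → α) : Prop :=
  ∀ θ x, p (rotZ θ x) = p x

/-! ### Cylindrical coordinates, frame and velocity components -/

/-- The cylindrical radius `r = √(x₀² + x₁²)`, the distance to the axis (KNSS 2009, §1). [cite: KNSS2009, §1] -/
def cylRadius (x : ℝ³) : ℝ :=
  Real.sqrt (x 0 ^ 2 + x 1 ^ 2)

/-- The cylindrical radius is nonnegative. [folklore] -/
theorem cylRadius_nonneg (x : ℝ³) : 0 ≤ cylRadius x :=
  Real.sqrt_nonneg _

/-- `r² = x₀² + x₁²`. [folklore] -/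
theorem cylRadius_sq (x : ℝ³) : cylRadius x ^ 2 = x 0 ^ 2 + x 1 ^ 2 :=
  Real.sq_sqrt (by positivity)

/-- `r = 0` exactly on the axis `x₀ = x₁ = 0`. [folklore] -/
theorem cylRadius_eq_zero_iff (x : ℝ³) : cylRadius x = 0 ↔ x 0 = 0 ∧ x 1 = 0 := by
  rw [cylRadius, Real.sqrt_eq_zero (by positivity)]
  constructor
  · intro h
    exact ⟨by nlinarith [sq_nonneg (x 0), sq_nonneg (x 1)],
      by nlinarith [sq_nonneg (x 0), sq_nonneg (x 1)]⟩
  · rintro ⟨h0, h1⟩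
    simp [h0, h1]

/-- The cylindrical radius is continuous. [folklore] -/
theorem continuous_cylRadius : Continuous cylRadius := by
  unfold cylRadius
  fun_prop

/-- The cylindrical radius is invariant under rotations about the axis. [folklore] -/
theorem cylRadius_rotZ (θ : ℝ) (x : ℝ³) : cylRadius (rotZ θ x) = cylRadius x := by
  unfold cylRadius
  congr 1
  simp only [rotZ_apply_zero, rotZ_apply_one]
  linear_combination (x 0 ^ 2 + x 1 ^ 2) * Real.sin_sq_add_cos_sq θ

/-- The cylindrical radius is absolutely homogeneous: `r (c • x) = |c| r (x)`. [folklore] -/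
theorem cylRadius_smul (c : ℝ) (x : ℝ³) : cylRadius (c • x) = |c| * cylRadius x := by
  simp only [cylRadius, PiLp.smul_apply, smul_eq_mul, mul_pow, ← mul_add]
  rw [Real.sqrt_mul (sq_nonneg c), Real.sqrt_sq_eq_abs]

/-- The radial unit vector `e_r = (x₀, x₁, 0)/r` of the cylindrical frame (KNSS 2009, (1.5)).
Junk value `0` on the axis `r = 0` (from `0⁻¹ = 0`). [cite: KNSS2009, (1.5)] -/
def eR (x : ℝ³) : ℝ³ :=
  (cylRadius x)⁻¹ • toLp 2 ![x 0, x 1, 0]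

/-- The angular unit vector `e_θ = (−x₁, x₀, 0)/r` of the cylindrical frame (KNSS 2009, (1.5)).
Junk value `0` on the axis `r = 0` (from `0⁻¹ = 0`). [cite: KNSS2009, (1.5)] -/
def eTheta (x : ℝ³) : ℝ³ :=
  (cylRadius x)⁻¹ • toLp 2 ![-x 1, x 0, 0]

/-- The axial unit vector `e_z = (0, 0, 1)` (KNSS 2009, (1.5)). [cite: KNSS2009, (1.5)] -/
def eZ : ℝ³ :=
  EuclideanSpace.single 2 1

/-- The radial velocity component `u_r (x) = ⟪u x, e_r x⟫` (KNSS 2009, (1.5)–(1.6)). Junk value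
`0` on the axis (where `eR = 0`). [cite: KNSS2009, (1.5)] -/
def radialVelocity (u : ℝ³ → ℝ³) (x : ℝ³) : ℝ :=
  ⟪u x, eR x⟫

/-- The swirl (angular) velocity component `u_θ (x) = ⟪u x, e_θ x⟫` (KNSS 2009, (1.5)–(1.6);
Chen–Hou 2022, (1.1)). Junk value `0` on the axis (where `eTheta = 0`). [cite: KNSS2009, (1.5)] -/
def swirlVelocity (u : ℝ³ → ℝ³) (x : ℝ³) : ℝ :=
  ⟪u x, eTheta x⟫

/-- The axial velocity component `u_z (x) = u x 2` (KNSS 2009, (1.5)–(1.6)). [cite: KNSS2009, (1.5)] -/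
def axialVelocity (u : ℝ³ → ℝ³) (x : ℝ³) : ℝ :=
  u x 2

/-- The **swirl** `Γ (x) = r u_θ = x₀ u₁ (x) − x₁ u₀ (x)` of a velocity field (KNSS 2009, (1.8):
`Γ := r u_θ`; Majda–Bertozzi, §2.3.3). This polynomial expression is junk-free (no division by
`r`) and vanishes on the axis; off the axis it equals `cylRadius x * swirlVelocity u x`
(`swirl_eq_cylRadius_mul_swirlVelocity`). [cite: KNSS2009, (1.8)] -/
def swirl (u : ℝ³ → ℝ³) (x : ℝ³) : ℝ :=
  x 0 * u x 1 - x 1 * u x 0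

/-- A velocity field has *no swirl* if `Γ = r u_θ ≡ 0`, i.e. `u_θ ≡ 0`
(`hasNoSwirl_iff_swirlVelocity`) (Elgindi 2021, §1.2: axisymmetric solutions without swirl;
Majda–Bertozzi, §2.3.3). [cite: Elgindi2021, §1.2: axisymmetric solutions without swi] -/
def HasNoSwirl (u : ℝ³ → ℝ³) : Prop :=
  ∀ x, swirl u x = 0

/-- On the axis the swirl vanishes: `Γ = 0` where `r = 0`. [folklore] -/
theorem swirl_eq_zero_of_cylRadius_eq_zero (u : ℝ³ → ℝ³) {x : ℝ³} (hx : cylRadius x = 0) :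
    swirl u x = 0 := by
  obtain ⟨h0, h1⟩ := (cylRadius_eq_zero_iff x).1 hx
  simp [swirl, h0, h1]

/-- Off the axis, `Γ = r u_θ`: `swirl u x = cylRadius x * swirlVelocity u x` for `r ≠ 0`
(KNSS 2009, (1.8)). [cite: KNSS2009, (1.8)] -/
theorem swirl_eq_cylRadius_mul_swirlVelocity (u : ℝ³ → ℝ³) {x : ℝ³} (hx : cylRadius x ≠ 0) :
    swirl u x = cylRadius x * swirlVelocity u x := by
  simp only [swirl, swirlVelocity, eTheta, PiLp.inner_apply, Fin.sum_univ_three,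
    PiLp.smul_apply, RCLike.inner_apply, conj_trivial, smul_eq_mul,
    Matrix.cons_val_zero, Matrix.cons_val_one, Matrix.cons_val_two, Matrix.head_cons,
    Matrix.tail_cons]
  field_simp
  ring

/-- `Γ ≡ 0` iff `u_θ ≡ 0`; this holds for every field because both sides vanish on the axis
(`swirl` genuinely, `swirlVelocity` by its junk value) (Elgindi 2021, §1.2). [cite: Elgindi2021, §1.2] -/
theorem hasNoSwirl_iff_swirlVelocity (u : ℝ³ → ℝ³) :
    HasNoSwirl u ↔ ∀ x, swirlVelocity u x = 0 := by
  refine forall_congr' fun x => ?_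
  by_cases hx : cylRadius x = 0
  · have h1 : swirlVelocity u x = 0 := by simp [swirlVelocity, eTheta, hx]
    simp [swirl_eq_zero_of_cylRadius_eq_zero u hx, h1]
  · rw [swirl_eq_cylRadius_mul_swirlVelocity u hx, mul_eq_zero, or_iff_right hx]

/-- The swirl of an axisymmetric field is an axisymmetric scalar: `Γ (R_θ x) = Γ (x)`
(KNSS 2009, §1: `Γ = Γ(r, z, t)`). [cite: KNSS2009, §1] -/
theorem IsAxisymmetric.swirl_rotZ {u : ℝ³ → ℝ³} (hu : IsAxisymmetric u) (θ : ℝ) (x : ℝ³) :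
    swirl u (rotZ θ x) = swirl u x := by
  simp only [swirl, hu θ x, rotZ_apply_zero, rotZ_apply_one]
  linear_combination (x 0 * u x 1 - x 1 * u x 0) * Real.sin_sq_add_cos_sq θ

/-- The swirl of an axisymmetric field is an axisymmetric scalar (bundled form of
`IsAxisymmetric.swirl_rotZ`). [folklore] -/
theorem IsAxisymmetric.isAxisymmetricScalar_swirl {u : ℝ³ → ℝ³} (hu : IsAxisymmetric u) :
    IsAxisymmetricScalar (swirl u) :=
  hu.swirl_rotZ

/-! ### Swirl transport and propagation of axisymmetry (whole space) -/

/-- **Transport–diffusion of the swirl.** For a classical Navier–Stokes solution on `ℝ³ × S`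
with axisymmetric velocity and pressure, the swirl `Γ = r u_θ = x₀u₁ − x₁u₀` satisfies, off the
axis,
`∂ₜΓ + (u·∇)Γ = ν (ΔΓ − (2/r) ∂ᵣΓ) + (x₀f₁ − x₁f₀)`
(KNSS 2009, eq. (1.8), with the forcing term `swirl (f t)`, absent there since `f = 0`;
Chen–Hou 2022, (1.1) for `ν = 0`; Majda–Bertozzi, §2.3.3, eq. (2.58)–(2.59)). Here `∂ᵣ` is the
directional derivative along `eR x`. Proof: `x₀ · (eq. for u₁) − x₁ · (eq. for u₀)`, the pressure
term `x₀∂₁p − x₁∂₀p = ∂_θ p` vanishes by axisymmetry of `p`, and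
`x₀Δu₁ − x₁Δu₀ = ΔΓ − 2(∂₀u₁ − ∂₁u₀) = ΔΓ − (2/r)∂ᵣΓ` for axisymmetric `u`. [cite: KNSS2009, eq. (1.8)] -/
def swirl_transport : Prop :=
  ∀ {S : Set ℝ} {ν : ℝ} {f u : ℝ → ℝ³ → ℝ³} {p : ℝ → ℝ³ → ℝ} (h : IsClassicalNSSolutionOn S ν f u p) (hu : ∀ t ∈ S, IsAxisymmetric (u t)) (hp : ∀ t ∈ S, IsAxisymmetricScalar (p t)) {t : ℝ} (ht : t ∈ S) {x : ℝ³} (hx : cylRadius x ≠ 0),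
    timeDerivWithin S (fun s => swirl (u s)) t x + convect (u t) (swirl (u t)) x =
      ν * ((Δ (swirl (u t))) x - 2 / cylRadius x * partialDeriv (eR x) (swirl (u t)) x) +
        swirl (f t) x

/-- **Propagation of axisymmetry.** A classical Navier–Stokes (`0 < ν`) or Euler (`ν = 0`)
solution on `ℝ³ × [0, T)` with Schwartz-type spatial decay, axisymmetric forcing and
axisymmetric initial velocity stays axisymmetric (KNSS 2009, §1; Majda–Bertozzi, §2.3.3).
Proof: `(t, x) ↦ R_θ u(t, R_{−θ} x)`, `p(t, R_{−θ} x)` is again a decaying classical solution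
with the same force and data (rotation invariance of the equations, `norm_rotZ`, `rotZ_add`),
and decaying classical solutions are unique (energy estimate for the difference; the difference
of the two pressure gradients is Schwartz by the momentum equation; Majda–Bertozzi, §3.1.1,
Cor. 3.1 of the basic energy estimate Prop. 3.1, stated there for `ν ≥ 0`, i.e. Euler and
Navier–Stokes alike — an earlier version of this docstring mis-cited it as "Prop. 3.9"). Proved:
`IsClassicalNSSolutionOn.isAxisymmetric_of_data_holds` (`AxisymmetricEulerProofs`). [cite: KNSS2009, §1] -/
def IsClassicalNSSolutionOn.isAxisymmetric_of_data : Prop :=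
  ∀ {T ν : ℝ} {f u : ℝ → ℝ³ → ℝ³} {p : ℝ → ℝ³ → ℝ} (hν : 0 ≤ ν) (h : IsClassicalNSSolutionOn (Ico 0 T) ν f u p) (hdec : HasUniformRapidDecayOn (Ico 0 T) u) (hf : ∀ t ∈ Ico 0 T, IsAxisymmetric (f t)) (h0 : IsAxisymmetric (u 0)),
    ∀ t ∈ Ico 0 T, IsAxisymmetric (u t)

/-! ### Classical Euler solutions on domains with boundary -/

section Domain

variable {E : Type*} [NormedAddCommGroup E] [InnerProductSpace ℝ E] [FiniteDimensional ℝ E]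

/-- Classical solutions of the forced incompressible **Euler** equations in an open set
`Ω : Opens E` with impermeable boundary, on the time set `S ⊆ ℝ`:
`∂ₜu + (u·∇)u = −∇p + f`, `div u = 0` in `S × Ω`, `u · n = 0` on `S × ∂Ω`, with `u`, `p` of
class `C¹` on `S × closure Ω` (Majda–Bertozzi, §1.2, eqs. (1.19)–(1.20) and the boundary
condition `v · n = 0`; Elgindi 2021, §1.2; Chen–Hou 2022, (1.1)–(1.3) with the no-flow condition
on `r = 1`). The outward normal field `n : E → E` on `frontier Ω` is an argument (e.g. `eR` for
`unitCylinder`); the time derivative is the one-sided `timeDerivWithin S`, the spatial derivatives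
are plain Fréchet derivatives at the interior points `x ∈ Ω`. [cite: Elgindi2021, §1.2] -/
structure IsClassicalEulerOnDomain (S : Set ℝ) (Ω : Opens E) (n : E → E) (f u : ℝ → E → E)
    (p : ℝ → E → ℝ) : Prop where
  /-- `u` and `p` are `C¹` on `S × closure Ω` (up to the boundary). -/
  smooth : ContDiffOn ℝ 1 (uncurry u) (S ×ˢ closure (Ω : Set E)) ∧
    ContDiffOn ℝ 1 (uncurry p) (S ×ˢ closure (Ω : Set E))
  /-- The momentum equation `∂ₜu + (u·∇)u = −∇p + f` in `S × Ω` (Majda–Bertozzi, (1.19)). -/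
  momentum : ∀ t ∈ S, ∀ x ∈ Ω,
    timeDerivWithin S u t x + convect (u t) (u t) x = -gradient (p t) x + f t x
  /-- Incompressibility `div u = 0` in `S × Ω` (Majda–Bertozzi, (1.20)). -/
  divFree : ∀ t ∈ S, ∀ x ∈ Ω, VectorCalculus.divergence (u t) x = 0
  /-- The slip (no-penetration) boundary condition `u · n = 0` on `S × ∂Ω`. -/
  slip : ∀ t ∈ S, ∀ x ∈ frontier (Ω : Set E), ⟪u t x, n x⟫ = 0

/-- The velocity of a classical Euler solution on a domain is `C¹` up to the boundary
(field projection). [folklore] -/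
theorem IsClassicalEulerOnDomain.contDiffOn_velocity {S : Set ℝ} {Ω : Opens E} {n : E → E}
    {f u : ℝ → E → E} {p : ℝ → E → ℝ} (h : IsClassicalEulerOnDomain S Ω n f u p) :
    ContDiffOn ℝ 1 (uncurry u) (S ×ˢ closure (Ω : Set E)) :=
  h.smooth.1

/-- A field `v : E → F'` has *finite energy* if `∫ ‖v‖² < ∞`, i.e. `v ∈ L²` in the extended
sense of the accepted `Literature.Analysis.FluidPDE.eEnergy` (Elgindi 2021, §1.2: finite-energy `C^{1,α}`
solutions; Fefferman, (7)). [cite: Elgindi2021, §1.2: finite-energy  C^{1 α}  solutions] -/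
def HasFiniteEnergy [MeasurableSpace E] [BorelSpace E] {F' : Type*} [NormedAddCommGroup F'] (v : E → F') :
    Prop :=
  eEnergy v < ∞

end Domain

/-- The open unit cylinder `{x | r < 1} = {x₀² + x₁² < 1}` about the axis, the spatial domain of
Chen–Hou 2022, §1.1 (with periodicity in `z`); its outward unit normal on `{r = 1}` is `eR`.
Openness: preimage of `Iio 1` under the continuous `cylRadius`. [cite: ChenHou2022, §1.1] -/
def unitCylinder : Opens ℝ³ :=
  ⟨{x | cylRadius x < 1}, isOpen_lt continuous_cylRadius continuous_const⟩

/-- Membership in the unit cylinder: `x ∈ unitCylinder ↔ r < 1`. [folklore] -/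
@[simp]
theorem mem_unitCylinder {x : ℝ³} : x ∈ unitCylinder ↔ cylRadius x < 1 :=
  Iff.rfl

/-- The boundary of the unit cylinder is the surface `{r = 1}` (Chen–Hou 2022, §1.1: the
no-flow condition is imposed on `r = 1`). Proof: `frontier {r < 1} ⊆ {r = 1}` by continuity
(Mathlib `frontier_lt_subset_eq`), and every point with `r = 1` is a limit of points with
`r < 1`, `x = lim_{c ↑ 1} c • x` (`cylRadius_smul`), and is not an interior point. [cite: ChenHou2022, §1.1: the no-flow condition is imposed o] -/
theorem frontier_unitCylinder :
    frontier (unitCylinder : Set ℝ³) = {x | cylRadius x = 1} := by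
  refine Subset.antisymm (frontier_lt_subset_eq continuous_cylRadius continuous_const) ?_
  intro x hx
  rw [mem_setOf_eq] at hx
  rw [frontier, Set.mem_sdiff]
  refine ⟨?_, fun h => ?_⟩
  · have ht : Tendsto (fun c : ℝ => c • x) (𝓝[<] 1) (𝓝 x) := by
      have : Tendsto (fun c : ℝ => c • x) (𝓝 1) (𝓝 ((1 : ℝ) • x)) :=
        tendsto_id.smul tendsto_const_nhds
      rw [one_smul] at this
      exact this.mono_left nhdsWithin_le_nhds
    refine mem_closure_of_tendsto ht ?_
    filter_upwards [Ioo_mem_nhdsLT one_pos] with c hc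
    show cylRadius (c • x) < 1
    rw [cylRadius_smul, hx, mul_one, abs_of_pos hc.1]
    exact hc.2
  · have h' : x ∈ (unitCylinder : Set ℝ³) := interior_subset h
    rw [SetLike.mem_coe, mem_unitCylinder, hx] at h'
    exact lt_irrefl 1 h'

/-- The unit cylinder is invariant under rotations about the axis. [folklore] -/
theorem rotZ_mem_unitCylinder_iff (θ : ℝ) {x : ℝ³} :
    rotZ θ x ∈ unitCylinder ↔ x ∈ unitCylinder := by
  simp [cylRadius_rotZ]

/-- Periodicity in the axial variable with period `L`: `v (x + L e_z) = v x`
(Chen–Hou 2022, §1.1: the equations are posed on `{r ≤ 1} × 𝕋_z`). [cite: ChenHou2022, §1.1: the equations are posed on  {r ≤ 1] -/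
def IsAxiallyPeriodic {F : Sort*} (L : ℝ) (v : ℝ³ → F) : Prop :=
  ∀ x, v (x + L • EuclideanSpace.single (2 : Fin 3) (1 : ℝ)) = v x

/-- The Hölder class `C^{1,α}(ℝ³; ℝ³)` of velocity fields (Elgindi 2021, §1.2: blow-up for
`C^{1,α}` solutions of 3D Euler, `α > 0` small): an abbreviation of the accepted G03 class
`Literature.MemContDiffHolder 1 α` (`C¹`, bounded `v`, `Dv`, and `Dv` `α`-Hölder). [cite: Elgindi2021, §1.2: blow-up for  C^{1 α}  solutions of] -/
abbrev MemC1Holder (α : ℝ≥0) (v : ℝ³ → ℝ³) : Prop :=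
  FunctionSpaces.MemContDiffHolder 1 α v

/-- **Vorticity blow-up at time `T`**: `limsup_{t ↑ T} ‖ω(t)‖_{L^∞} = ∞`, stated without
suprema as: for every bound `M`, frequently as `t ↑ T` some point has `‖curl u(t, x)‖ > M`
(the Beale–Kato–Majda form of singularity formation, Majda–Bertozzi, Thm. 3.6 / (3.72);
Elgindi 2021, §1.2; Chen–Hou 2022, Thm. 1.1). [cite: Elgindi2021, §1.2] -/
def VorticityBlowsUpAt (u : ℝ → ℝ³ → ℝ³) (T : ℝ) : Prop :=
  ∀ M : ℝ, ∃ᶠ t in 𝓝[<] T, ∃ x, M < ‖curl (u t) x‖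

/-- Vorticity blow-up in terms of the accepted `Literature.Analysis.FluidPDE.vorticity` (definitional). [folklore] -/
theorem vorticityBlowsUpAt_iff (u : ℝ → ℝ³ → ℝ³) (T : ℝ) :
    VorticityBlowsUpAt u T ↔ ∀ M : ℝ, ∃ᶠ t in 𝓝[<] T, ∃ x, M < ‖vorticity u t x‖ :=
  Iff.rfl

end Literature.Analysis.FluidPDE
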